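import Literature.Computability.Complexity.PCPSubsetNP
import Literature.Computability.Complexity.EasyWitnessSearch
import HarnessLib

/-!
# A PCP verifier run against a proof described by a circuit: Arthur's predicate (Buhrman–Fortnow–Pavan, Lemma 3.4)

Literature / complexity toolkit, companion of `PCPSubsetNP.lean` (the verifier's maps as total `FP`
string functions `PCPExact.QF`, `PCPExact.DF`, the answer fold) and `CircuitEval.lean` (the
polynomial-time circuit evaluator `CircEval.evalFn` with `evalFn ⟨w, desc C⟩ = [C(w)]`, through
`EasyWitnessSearch.lean` for its one-bit form `EasyWitness.evalFn_eq_singleton`). In the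
proof of Lemma 3.4 of Buhrman–Fortnow–Pavan (*Some results on derandomization*, Theory Comput.
Syst. 38 (2005); authors' version p. 5):

> "Merlin just sends over this circuit and Arthur probabilistically verifies this proof in time
> polynomial in `n` with random access to the proof which he can simulate by evaluating the circuit"

— a Merlin–Arthur protocol whose Arthur runs a nonadaptive PCP verifier `V` (`PCPVerifier`,
`PCP.lean`) with every oracle query answered by EVALUATING A CIRCUIT whose description Merlin sent.
This file assembles that Arthur as ONE total polynomial-time string predicate, in the input format
`⟨⟨x, y⟩, z⟩` of the tree's Merlin–Arthur scaling theorem (`MAScale.exists_NTIME_of_referee`,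
`PromiseMAScaling.lean`): `x` the input, `y = ⟨v, ⟨D, pad⟩⟩` Merlin's message (an address width
`t = |v|` in unary, a circuit description `D` for the evaluator, padding), `z` Arthur's coins.

* `PCPCkt.proofOf x v D : ℕ → Bool` — **the proof read off a circuit description**: position `k` is
  the evaluator's bit on `⟨⟨x, addr⟩, D⟩` with `addr` the `|v|`-bit little-endian address of `k`
  (`PCPExact.coinStr |v| k`), and `false` for positions that do not fit into `|v|` bits — a total
  function of `(x, v, D)`, whatever the shape of `D` (`proofOf_of_length_le`, `proofOf_of_lt_length`);
* `PCPCkt.bitF`, `PCPCkt.answersF` — the proof bit and the answers to a coded query list as `FP`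
  bricks (`prfAnswersF_keys`);
* `PCPCkt.artF V p` — **Arthur's predicate**: run `V` on the coin strings `ρ₁ = z↾r`,
  `ρ₂ = (z↓r)↾r`, `r = p(|x|)` the verifier's (polynomial) coin count, with the proof `proofOf x v D`,
  and accept iff both runs accept
  (two independent runs square the soundness error `1/2` of `V`); **`artF_mem_FP`**, **`artF_apply`**.

Everything is definitions-with-value-lemmas in the `FP` brick algebra; no named facts.

## References

* H. Buhrman, L. Fortnow, A. Pavan, *Some results on derandomization*, Theory Comput. Syst. 38
  (2005) 211–227, Lemma 3.4 and its proof (authors' version, p. 5) [BuhrmanFortnowPavan2004].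
* S. Arora, B. Barak, *Computational Complexity: A Modern Approach*, CUP 2009, Def. 11.4
  (nonadaptive PCP verifier), Def. 8.10 (`MA`), Thm. 6.18 proof (circuit evaluation in `P`)
  [AroraBarakCC2009].
-/

noncomputable section

namespace Literature.Computability.Complexity

open _root_.Computability Polynomial Brick

namespace PCPCkt

/-! ### The proof bit read off a circuit description

Item arguments have the shape `⟨a, ctx⟩` with `a = bin k` a coded position and
`ctx = ⟨⟨x, v⟩, D⟩` the context (input, address width in unary, circuit description). -/

/-- The pair `⟨v, a⟩` extracted from `⟨a, ⟨⟨x, v⟩, D⟩⟩`. [folklore] -/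
def vaF : List Bool → List Bool := fanoutFn (sndF ∘ fstF ∘ sndF) fstF

/-- The address: `takeD |v| a false` (the position `a` padded / truncated to `|v|` bits). [folklore] -/
def addrF : List Bool → List Bool := fstF ∘ padTakeFn ∘ vaF

/-- The in-range bit `[a↓|v| = []]`, i.e. `[|a| ≤ |v|]`. [folklore] -/
def inRangeF : List Bool → List Bool := isNilFn ∘ sndF ∘ padTakeFn ∘ vaF

/-- The evaluator's input `⟨⟨x, addr⟩, D⟩`. [folklore] -/
def evInF : List Bool → List Bool :=
  fanoutFn (fanoutFn (fstF ∘ fstF ∘ sndF) addrF) (sndF ∘ sndF)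

/-- **The proof bit** on `⟨a, ⟨⟨x, v⟩, D⟩⟩`: `[|a| ≤ |v| ∧ evalFn ⟨⟨x, addr⟩, D⟩ = [1]]`.
[cite: BuhrmanFortnowPavan2004, Lemma 3.4 (proof)] -/
def prfBitF : List Bool → List Bool := andFn inRangeF (CircEval.evalFn ∘ evInF)

/-- Value of `vaF` on an item argument. [folklore] -/
theorem vaF_apply (a x v D : List Bool) : vaF (boolPair a (boolPair (boolPair x v) D)) = boolPair v a := by
  simp [vaF]

/-- Value of `addrF`: the address `takeD |v| a false`. [folklore] -/
theorem addrF_apply (a x v D : List Bool) :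
    addrF (boolPair a (boolPair (boolPair x v) D)) = a.takeD v.length false := by
  simp [addrF, vaF_apply]

/-- Value of `inRangeF`: `[a↓|v| = []]`. [folklore] -/
theorem inRangeF_apply (a x v D : List Bool) :
    inRangeF (boolPair a (boolPair (boolPair x v) D)) = [decide (a.drop v.length = [])] := by
  simp only [inRangeF, Function.comp_apply, vaF_apply, padTakeFn_boolPair, sndF_boolPair]
  rfl

/-- Value of `evInF`: the evaluator's input `⟨⟨x, addr⟩, D⟩`. [folklore] -/
theorem evInF_apply (a x v D : List Bool) :
    evInF (boolPair a (boolPair (boolPair x v) D)) = boolPair (boolPair x (a.takeD v.length false)) D := by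
  simp [evInF, addrF_apply]

/-- **Value of the proof bit.** [folklore] -/
theorem prfBitF_apply (a x v D : List Bool) :
    prfBitF (boolPair a (boolPair (boolPair x v) D)) =
      [decide (a.drop v.length = []) &&
        (CircEval.evalFn (boolPair (boolPair x (a.takeD v.length false)) D)).headD false] := by
  unfold prfBitF
  refine andFn_apply (inRangeF_apply a x v D) ?_
  rw [Function.comp_apply, evInF_apply]
  exact EasyWitness.evalFn_eq_singleton _

/-- `prfBitF` is one-bit. [folklore] -/
theorem oneBit_prfBitF : OneBit prfBitF := by
  unfold prfBitF
  refine oneBit_andFn (fun z => ⟨_, rfl⟩) fun z => ⟨_, EasyWitness.evalFn_eq_singleton _⟩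

/-- `prfBitF ∈ FP`. [folklore] -/
theorem prfBitF_mem_FP : prfBitF ∈ FP := by
  have hva : vaF ∈ FP := fanoutFn_mem_FP (comp_mem_FP sndF_mem_FP (comp_mem_FP fstF_mem_FP sndF_mem_FP)) fstF_mem_FP
  have haddr : addrF ∈ FP := comp_mem_FP fstF_mem_FP (comp_mem_FP padTakeFn_mem_FP hva)
  have hin : inRangeF ∈ FP := comp_mem_FP isNilFn_mem_FP (comp_mem_FP sndF_mem_FP (comp_mem_FP padTakeFn_mem_FP hva))
  have hev : evInF ∈ FP := fanoutFn_mem_FP (fanoutFn_mem_FP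
    (comp_mem_FP fstF_mem_FP (comp_mem_FP fstF_mem_FP sndF_mem_FP)) haddr) (comp_mem_FP sndF_mem_FP sndF_mem_FP)
  exact andFn_mem_FP hin (comp_mem_FP CircEval.evalFn_mem_FP hev)

/-- **The proof read off a circuit description**: `π_{x,v,D}(k)` is the proof bit at the coded
position `bin k` — the evaluator's bit on `⟨⟨x, coinStr |v| k⟩, D⟩` when `bin k` fits into `|v|`
bits, and `false` otherwise. A total function of `(x, v, D)`.
[cite: BuhrmanFortnowPavan2004, Lemma 3.4 (proof)] -/
def proofOf (x v D : List Bool) (k : ℕ) : Bool :=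
  (prfBitF (boolPair (encodeNat k) (boolPair (boolPair x v) D))).headD false

/-- The proof bit at `bin k` is `[π(k)]`. [folklore] -/
theorem prfBitF_encodeNat (x v D : List Bool) (k : ℕ) :
    prfBitF (boolPair (encodeNat k) (boolPair (boolPair x v) D)) = [proofOf x v D k] := by
  rw [proofOf, prfBitF_apply]; rfl

/-- In range: `π(k)` is the evaluator's bit at the `|v|`-bit address of `k`. [folklore] -/
theorem proofOf_of_length_le {x v D : List Bool} {k : ℕ} (hk : (encodeNat k).length ≤ v.length) :
    proofOf x v D k =
      (CircEval.evalFn (boolPair (boolPair x (PCPExact.coinStr v.length k)) D)).headD false := by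
  rw [proofOf, prfBitF_apply, List.drop_of_length_le hk]
  simp [PCPExact.coinStr]

/-- Out of range: `π(k) = false`. [folklore] -/
theorem proofOf_of_lt_length {x v D : List Bool} {k : ℕ} (hk : v.length < (encodeNat k).length) :
    proofOf x v D k = false := by
  rw [proofOf, prfBitF_apply]
  have h : (encodeNat k).drop v.length ≠ [] := by
    intro h
    have := List.drop_eq_nil_iff.1 h
    omega
  simp [h]

/-! ### The answers to a coded query list -/

/-- Step of the answer fold on `⟨⟨ctx, K⟩, ⟨a, acc⟩⟩`: `acc ++ prfBitF ⟨a, ctx⟩`. [folklore] -/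
def prfStepF : List Bool → List Bool :=
  appF ∘ fanoutFn (sndPow 1) (prfBitF ∘ fanoutFn (nthF 1) (fstF ∘ nthF 0))

/-- Value of the fold step. [folklore] -/
theorem prfStepF_apply (w a acc : List Bool) :
    prfStepF (boolPair w (boolPair a acc)) = acc ++ prfBitF (boolPair a (fstF w)) := by
  simp [prfStepF, appF]

/-- `prfStepF ∈ FP`. [folklore] -/
theorem prfStepF_mem_FP : prfStepF ∈ FP :=
  comp_mem_FP appF_mem_FP (fanoutFn_mem_FP (sndPow_mem_FP 1)
    (comp_mem_FP prfBitF_mem_FP (fanoutFn_mem_FP (nthF_mem_FP 1) (comp_mem_FP fstF_mem_FP (nthF_mem_FP 0)))))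

/-- `prfStepF` adds one symbol per round (growth `1`). [folklore] -/
theorem foldGrowth_prfStepF : FoldGrowth 1 prfStepF := fun v => by
  have h : prfStepF v = sndPow 1 v ++ prfBitF (boolPair (nthF 1 v) (fstF (nthF 0 v))) := by
    simp [prfStepF, appF]
  rw [h, List.length_append, oneBit_prfBitF.length_eq]
  simp only [sndPow, Function.comp_apply]
  omega

/-- The answer function `⟨ctx, K⟩ ↦` concatenated proof bits of the items of the coded list `K`. [folklore] -/
def prfAnswersF : List Bool → List Bool := foldFn prfStepF (fun _ => [])

/-- `prfAnswersF ∈ FP`. [folklore] -/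
theorem prfAnswersF_mem_FP : prfAnswersF ∈ FP :=
  foldFn_mem_FP prfStepF_mem_FP (const_mem_FP _) foldGrowth_prfStepF

/-- The left fold of `prfStepF` concatenates the proof bits. [folklore] -/
theorem foldl_prfStepF (w : List Bool) : ∀ (l : List (List Bool)) (acc : List Bool),
    l.foldl (fun acc a => prfStepF (boolPair w (boolPair a acc))) acc =
      acc ++ l.flatMap fun a => prfBitF (boolPair a (fstF w))
  | [], acc => by simp
  | a :: l, acc => by
    rw [List.foldl_cons, prfStepF_apply, foldl_prfStepF w l]
    simp

/-- Value of `prfAnswersF` on a pair (every input shape of the list). [folklore] -/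
theorem prfAnswersF_boolPair (ctx K : List Bool) :
    prfAnswersF (boolPair ctx K) = (decNil K).flatMap fun a => prfBitF (boolPair a ctx) := by
  rw [prfAnswersF, foldFn_boolPair, foldl_prfStepF]
  simp

/-- **`prfAnswersF ⟨⟨⟨x, v⟩, D⟩, enc [bin k₁, …]⟩ = [π(k₁), …]`.** [folklore] -/
theorem prfAnswersF_keys (x v D : List Bool) (ks : List ℕ) :
    prfAnswersF (boolPair (boolPair (boolPair x v) D) (encList (ks.map encodeNat))) = ks.map (proofOf x v D) := by
  rw [prfAnswersF_boolPair, decNil_encList]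
  induction ks with
  | nil => rfl
  | cons k ks ih =>
    rw [List.map_cons, List.flatMap_cons, ih, prfBitF_encodeNat, List.map_cons]
    rfl

/-! ### Arthur's predicate -/

section Arthur

variable (V : PCPVerifier) (p : Polynomial ℕ)

/-- The context `⟨⟨x, v⟩, D⟩` extracted from `⟨⟨x, ⟨v, ⟨D, pad⟩⟩⟩, z⟩`. [folklore] -/
def ctxF : List Bool → List Bool :=
  fanoutFn (fanoutFn (fstF ∘ fstF) (fstF ∘ sndF ∘ fstF)) (nthF 1 ∘ sndF ∘ fstF)

/-- The coin count `r = p(|x|)` in unary. [folklore] -/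
def rF : List Bool → List Bool := Plumb.polyFn p ∘ fstF ∘ fstF

/-- The first coin string `ρ₁ = takeD r z false`. [folklore] -/
def rho1F : List Bool → List Bool := fstF ∘ padTakeFn ∘ fanoutFn (rF p) sndF

/-- The second coin string `ρ₂ = takeD r (z↓r) false`. [folklore] -/
def rho2F : List Bool → List Bool :=
  fstF ∘ padTakeFn ∘ fanoutFn (rF p) (sndF ∘ padTakeFn ∘ fanoutFn (rF p) sndF)

/-- One run of the verifier on the coin string extracted by `ρF`, the queries answered by the proof
read off Merlin's circuit: `[V.decide x ρ (answers)]`. [cite: BuhrmanFortnowPavan2004, Lemma 3.4 (proof)] -/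
def runF (ρF : List Bool → List Bool) : List Bool → List Bool :=
  PCPExact.DF V ∘ fanoutFn (fstF ∘ fstF)
    (fanoutFn ρF (prfAnswersF ∘ fanoutFn (ctxF) (sndF ∘ PCPExact.QF V ∘ fanoutFn (fstF ∘ fstF) ρF)))

/-- **Arthur's predicate** of the Merlin–Arthur protocol of BFP's Lemma 3.4: two independent runs of
the verifier against the proof described by Merlin's circuit. [cite: BuhrmanFortnowPavan2004, Lemma 3.4 (proof)] -/
def artF : List Bool → List Bool := andFn (runF V (rho1F p)) (runF V (rho2F p))

variable {V p}

/-- Value of `ctxF`. [folklore] -/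
theorem ctxF_apply (x y z : List Bool) :
    ctxF (boolPair (boolPair x y) z) = boolPair (boolPair x (fstF y)) (nthF 1 y) := by
  simp [ctxF]

/-- Value of `rF`: `1^{p(|x|)}`. [folklore] -/
theorem rF_apply (x y z : List Bool) : rF p (boolPair (boolPair x y) z) = ones (p.eval x.length) := by
  simp [rF]

/-- Length of `rF`: `p(|x|)`. [folklore] -/
theorem length_rF (x y z : List Bool) : (rF p (boolPair (boolPair x y) z)).length = p.eval x.length := by
  rw [rF_apply]; simp [ones]

/-- Value of `rho1F`: `takeD r z false`. [folklore] -/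
theorem rho1F_apply (x y z : List Bool) :
    rho1F p (boolPair (boolPair x y) z) = z.takeD (p.eval x.length) false := by
  simp [rho1F, length_rF]

/-- Value of `rho2F`: `takeD r (z↓r) false`. [folklore] -/
theorem rho2F_apply (x y z : List Bool) :
    rho2F p (boolPair (boolPair x y) z) = (z.drop (p.eval x.length)).takeD (p.eval x.length) false := by
  simp [rho2F, length_rF]

/-- **Value of one run**: the verifier's verdict on the extracted coins with the proof `π_{x,v,D}`. [folklore] -/
theorem runF_apply {ρF : List Bool → List Bool} (x y z : List Bool) :
    runF V ρF (boolPair (boolPair x y) z) =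
      [V.accepts x (proofOf x (fstF y) (nthF 1 y)) (ρF (boolPair (boolPair x y) z))] := by
  simp only [runF, Function.comp_apply, fanoutFn_apply, fstF_boolPair, ctxF_apply, PCPExact.QF_boolPair,
    PCPExact.sndF_encode_listNat, prfAnswersF_keys, PCPExact.DF_record, PCPVerifier.accepts]

/-- `runF V ρF ∈ FP` for a polynomial-time verifier and `ρF ∈ FP`. [cite: AroraBarakCC2009, §1.3 (composition)] -/
theorem runF_mem_FP (hV : V.IsPolyTime) {ρF : List Bool → List Bool} (hρ : ρF ∈ FP) : runF V ρF ∈ FP := by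
  have hctx : ctxF ∈ FP := fanoutFn_mem_FP (fanoutFn_mem_FP (comp_mem_FP fstF_mem_FP fstF_mem_FP)
    (comp_mem_FP fstF_mem_FP (comp_mem_FP sndF_mem_FP fstF_mem_FP)))
    (comp_mem_FP (nthF_mem_FP 1) (comp_mem_FP sndF_mem_FP fstF_mem_FP))
  exact comp_mem_FP (PCPExact.DF_mem_FP hV) (fanoutFn_mem_FP (comp_mem_FP fstF_mem_FP fstF_mem_FP)
    (fanoutFn_mem_FP hρ (comp_mem_FP prfAnswersF_mem_FP (fanoutFn_mem_FP hctx
      (comp_mem_FP sndF_mem_FP (comp_mem_FP (PCPExact.QF_mem_FP hV)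
        (fanoutFn_mem_FP (comp_mem_FP fstF_mem_FP fstF_mem_FP) hρ)))))))

/-- `rF p ∈ FP`. [folklore] -/
theorem rF_mem_FP : rF p ∈ FP :=
  comp_mem_FP (Plumb.polyFn_mem_FP p) (comp_mem_FP fstF_mem_FP fstF_mem_FP)

/-- `rho1F p ∈ FP`. [folklore] -/
theorem rho1F_mem_FP : rho1F p ∈ FP :=
  comp_mem_FP fstF_mem_FP (comp_mem_FP padTakeFn_mem_FP (fanoutFn_mem_FP rF_mem_FP sndF_mem_FP))

/-- `rho2F p ∈ FP`. [folklore] -/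
theorem rho2F_mem_FP : rho2F p ∈ FP :=
  comp_mem_FP fstF_mem_FP (comp_mem_FP padTakeFn_mem_FP (fanoutFn_mem_FP rF_mem_FP
    (comp_mem_FP sndF_mem_FP (comp_mem_FP padTakeFn_mem_FP (fanoutFn_mem_FP rF_mem_FP sndF_mem_FP)))))

/-- **`artF V p ∈ FP`** for a polynomial-time verifier. [cite: BuhrmanFortnowPavan2004, Lemma 3.4 (proof: "in time polynomial in `n`")] -/
theorem artF_mem_FP (hV : V.IsPolyTime) : artF V p ∈ FP :=
  andFn_mem_FP (runF_mem_FP hV rho1F_mem_FP) (runF_mem_FP hV rho2F_mem_FP)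

/-- **Value of Arthur's predicate** on `⟨⟨x, y⟩, z⟩`: both runs of `V` — on `ρ₁ = takeD r z false` and
on `ρ₂ = takeD r (z↓r) false`, `r = p(|x|)` — accept `x` with the proof `π_{x, fstF y, nthF 1 y}`.
[cite: BuhrmanFortnowPavan2004, Lemma 3.4 (proof)] -/
theorem artF_apply (x y z : List Bool) :
    artF V p (boolPair (boolPair x y) z) =
      [V.accepts x (proofOf x (fstF y) (nthF 1 y)) (z.takeD (p.eval x.length) false) &&
        V.accepts x (proofOf x (fstF y) (nthF 1 y)) ((z.drop (p.eval x.length)).takeD (p.eval x.length) false)] := by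
  unfold artF
  rw [andFn_apply (runF_apply x y z) (runF_apply x y z), rho1F_apply, rho2F_apply]

end Arthur

end PCPCkt

end Literature.Computability.Complexity
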